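import Summits.NavierStokesRegularity.NavierStokesRegularity.Theorems.AdaptedFrequencyAdaptedKernelExistsKernelLimitSpace
import Summits.NavierStokesRegularity.NavierStokesRegularity.Theorems.AdaptedFrequencyAdaptedKernelExistsKernelLimitExtract
import Summits.NavierStokesRegularity.NavierStokesRegularity.Theorems.AdaptedFrequencyAdaptedKernelExistsKernelLimitWeak
import Summits.NavierStokesRegularity.NavierStokesRegularity.Theorems.AdaptedFrequencyAdaptedKernelExistsKernelLimitVeryWeakLimit
import Summits.NavierStokesRegularity.NavierStokesRegularity.Theorems.AdaptedFrequencyAdaptedKernelExistsKernelLimitConcentration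
import Summits.NavierStokesRegularity.NavierStokesRegularity.Theorems.AdaptedFrequencyAdaptedKernelExistsHypoelliptic

/-!
# Crux `AdaptedKernelExists` (stmt-NavierStokesRegularity-2956), line `nash-entropy-last-block`:
  STUB `stub_kernelLimit` — passage to the limit along uniformly comparable adapted kernels

Final file of the proof of the registered stub `stub_kernelLimit` (gen-4 skeleton): a smooth
divergence-free drift `b` on `[tₘ, T) × ℝ³`, bounded on blocks, admitting for every `T′ < T` a
drift `b′ = b` on `[tₘ, T′]` with an adapted kernel obeying FIXED two-sided Gaussian bounds,
carries itself an adapted kernel on `Ico t₀ T` with the same bounds.  Assembly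
(`kernelLimit_of_hypoelliptic`; `stub_kernelLimit` by the landed `stub_hypoelliptic`): kernels
`Gₙ` for `T′ₙ ↑ T`; equicontinuity in time (`kernelLimit_pairing_lipschitz`) and space
(`kernelLimit_space_modulus`); extraction (`kernelLimit_extract`); the limit keeps the bounds, unit
mass and the very weak equation (`kernelLimit_veryWeak_of_adapted`, `kernelLimit_veryWeak_limit`);
Hörmander smoothing gives a classical `g` equal to the limit a.e.; bounds transfer everywhere
(`kernelLimit_le_of_ae_le`), mass by dominated continuity, concentration by
`kernelLimit_concentration`, and the classical equation gives the `timeDerivWithin` form.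
-/

noncomputable section

open MeasureTheory Set Filter Topology Metric Function Real
open scoped Laplacian ContDiff
open Literature.Analysis.FluidPDE

namespace Summit.NavierStokesRegularity.NavierStokesRegularity.Theorems.AdaptedKernelExists.NashEntropyLastBlock

section Three

/-- **Passage to the limit, given hypoelliptic smoothing.**  The registered stub
`stub_kernelLimit` with the statement of the registered stub `stub_hypoelliptic` as an explicit
hypothesis (discharged below by the landed theorem). -/
theorem kernelLimit_of_hypoelliptic
    (hH : ∀ (ν ta T : ℝ) (b : ℝ → EuclideanSpace ℝ (Fin 3) → EuclideanSpace ℝ (Fin 3))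
      (w : ℝ × EuclideanSpace ℝ (Fin 3) → ℝ),
      0 < ν → ta < T →
      IsSmoothSpaceTimeOn (Ico ta T) b →
      (∀ t ∈ Ico ta T, VectorCalculus.IsDivFree (b t)) →
      LocallyIntegrableOn w (Ioo ta T ×ˢ univ) volume →
      (∀ φ : ℝ × EuclideanSpace ℝ (Fin 3) → ℝ, ContDiff ℝ ∞ φ → HasCompactSupport φ →
        tsupport φ ⊆ Ioo ta T ×ˢ univ →
        ∫ p, w p * (deriv (fun s => φ (s, p.2)) p.1 +
            fderiv ℝ (fun y => φ (p.1, y)) p.2 (b p.1 p.2) -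
            ν * (Δ (fun y => φ (p.1, y))) p.2) = 0) →
      ∃ g : ℝ → EuclideanSpace ℝ (Fin 3) → ℝ,
        IsSmoothSpaceTimeOn (Ioo ta T) g ∧
        (∀ᵐ p : ℝ × EuclideanSpace ℝ (Fin 3), p ∈ Ioo ta T ×ˢ univ → w p = g p.1 p.2) ∧
        ∀ t ∈ Ioo ta T, ∀ x,
          deriv (fun s => g s x) t + fderiv ℝ (g t) x (b t x) + ν * (Δ (g t)) x = 0) :
    ∀ (ν c₁ c₂ C₁ C₂ tₘ t₀ T : ℝ) (b : ℝ → EuclideanSpace ℝ (Fin 3) → EuclideanSpace ℝ (Fin 3))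
      (x₀ : EuclideanSpace ℝ (Fin 3)),
      0 < ν → 0 < c₁ → 0 < c₂ → 0 < C₁ → 0 < C₂ → tₘ < t₀ → t₀ < T →
      IsSmoothSpaceTimeOn (Ico tₘ T) b →
      (∀ t ∈ Ico tₘ T, VectorCalculus.IsDivFree (b t)) →
      (∀ t₁ t₂ : ℝ, tₘ ≤ t₁ → t₂ < T → ∃ Bd : ℝ, ∀ s ∈ Icc t₁ t₂, ∀ x, ‖b s x‖ ≤ Bd) →
      (∀ T' : ℝ, t₀ < T' → T' < T →
        ∃ (b' : ℝ → EuclideanSpace ℝ (Fin 3) → EuclideanSpace ℝ (Fin 3))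
          (G' : ℝ → EuclideanSpace ℝ (Fin 3) → ℝ),
          (∀ t ∈ Icc tₘ T', b' t = b t) ∧
          IsSmoothSpaceTimeOn (Ico tₘ T) b' ∧
          (∀ t ∈ Ico tₘ T, VectorCalculus.IsDivFree (b' t)) ∧
          (∀ t ∈ Ico tₘ T, ∀ x, ‖b' t x‖ ≤ ‖b t x‖) ∧
          IsAdaptedBackwardKernel ν b' (Ico tₘ T) T x₀ G' ∧
          (∀ t ∈ Ioo tₘ T, ∀ x,
            c₁ * (T - t) ^ (-(3:ℝ) / 2) * Real.exp (-(‖x - x₀‖ ^ 2) / (c₂ * (T - t))) ≤ G' t x) ∧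
          (∀ t ∈ Ioo tₘ T, ∀ x,
            G' t x ≤ C₁ * (T - t) ^ (-(3:ℝ) / 2) * Real.exp (-(‖x - x₀‖ ^ 2) / (C₂ * (T - t))))) →
      ∃ G : ℝ → EuclideanSpace ℝ (Fin 3) → ℝ,
        IsAdaptedBackwardKernel ν b (Ico t₀ T) T x₀ G ∧
        (∀ t ∈ Ico t₀ T, ∀ x,
          c₁ * (T - t) ^ (-(3:ℝ) / 2) * Real.exp (-(‖x - x₀‖ ^ 2) / (c₂ * (T - t))) ≤ G t x) ∧
        (∀ t ∈ Ico t₀ T, ∀ x,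
          G t x ≤ C₁ * (T - t) ^ (-(3:ℝ) / 2) * Real.exp (-(‖x - x₀‖ ^ 2) / (C₂ * (T - t)))) := by
  intro ν c₁ c₂ C₁ C₂ tₘ t₀ T b x₀ hν hc₁ hc₂ hC₁ hC₂ htₘ₀ ht₀T hb hdiv hbd hfam
  have htₘT : tₘ < T := htₘ₀.trans ht₀T
  have hIco : Ioo tₘ T ⊆ Ico tₘ T := Ioo_subset_Ico_self
  set O : Set (ℝ × EuclideanSpace ℝ (Fin 3)) := Ioo tₘ T ×ˢ univ with hO_def
  have hO : IsOpen O := isOpen_Ioo.prod isOpen_univ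
  -- the envelopes
  set lo : ℝ → EuclideanSpace ℝ (Fin 3) → ℝ := fun t x =>
    c₁ * (T - t) ^ (-(3:ℝ) / 2) * Real.exp (-(‖x - x₀‖ ^ 2) / (c₂ * (T - t))) with hlo
  set up : ℝ → EuclideanSpace ℝ (Fin 3) → ℝ := fun t x =>
    C₁ * (T - t) ^ (-(3:ℝ) / 2) * Real.exp (-(‖x - x₀‖ ^ 2) / (C₂ * (T - t))) with hup
  have hlo_pos : ∀ t, t < T → ∀ x, 0 < lo t x := fun t ht x => by
    simp only [hlo]; have := sub_pos.2 ht; positivity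
  /- Step 0: the sequence of kernels -/
  set Tn : ℕ → ℝ := fun n => T - (T - t₀) / ((n : ℝ) + 2) with hTn_def
  have hTt₀ : 0 < T - t₀ := sub_pos.2 ht₀T
  have hTn₀ : ∀ n, t₀ < Tn n := by
    intro n
    simp only [hTn_def]
    have h2 : (1 : ℝ) < (n : ℝ) + 2 := by
      have := (Nat.cast_nonneg n : (0:ℝ) ≤ n); linarith
    have : (T - t₀) / ((n : ℝ) + 2) < T - t₀ := div_lt_self hTt₀ h2
    linarith
  have hTnT : ∀ n, Tn n < T := by
    intro n
    simp only [hTn_def]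
    have : 0 < (T - t₀) / ((n : ℝ) + 2) := by positivity
    linarith
  have hTn_mono : ∀ m n : ℕ, m ≤ n → Tn m ≤ Tn n := by
    intro m n hmn
    simp only [hTn_def]
    have h1 : (T - t₀) / ((n : ℝ) + 2) ≤ (T - t₀) / ((m : ℝ) + 2) :=
      div_le_div_of_nonneg_left hTt₀.le (by positivity) (by exact_mod_cast Nat.add_le_add_right hmn 2)
    linarith
  have hTn_ev : ∀ t : ℝ, t < T → ∃ N : ℕ, ∀ n, N ≤ n → t ≤ Tn n := by
    intro t ht
    obtain ⟨N, hN⟩ := exists_nat_gt ((T - t₀) / (T - t))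
    refine ⟨N, fun n hn => ?_⟩
    simp only [hTn_def]
    have hTt : 0 < T - t := sub_pos.2 ht
    have h1 : (T - t₀) / (T - t) ≤ (n : ℝ) + 2 := by
      have : (N : ℝ) ≤ n := by exact_mod_cast hn
      linarith
    have h2 : (T - t₀) / ((n : ℝ) + 2) ≤ T - t := by
      rw [div_le_iff₀ (by positivity)]
      rw [div_le_iff₀ hTt] at h1
      linarith [h1]
    linarith
  choose bs Gs hagree hsm' hdiv' hdom hK hL hU using fun n => hfam (Tn n) (hTn₀ n) (hTnT n)
  /- Step 1: uniform bounds -/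
  have hBd : ∀ t₁ t₂ : ℝ, tₘ ≤ t₁ → t₂ < T → ∃ Bd : ℝ, 0 ≤ Bd ∧
      ∀ n, ∀ s ∈ Icc t₁ t₂, ∀ x, ‖bs n s x‖ ≤ Bd := by
    intro t₁ t₂ h₁ h₂
    obtain ⟨Bd, hBd⟩ := hbd t₁ t₂ h₁ h₂
    refine ⟨max Bd 0, le_max_right _ _, fun n s hs x => ?_⟩
    have hsI : s ∈ Ico tₘ T := ⟨h₁.trans hs.1, hs.2.trans_lt h₂⟩
    exact ((hdom n s hsI x).trans (hBd s hs x)).trans (le_max_left _ _)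
  have hup_le : ∀ t₂ : ℝ, t₂ < T → ∀ t, t ≤ t₂ → ∀ x, up t x ≤ C₁ * (T - t₂) ^ (-(3:ℝ) / 2) := by
    intro t₂ ht₂ t ht x
    simp only [hup]
    have h1 : Real.exp (-(‖x - x₀‖ ^ 2) / (C₂ * (T - t))) ≤ 1 := by
      rw [Real.exp_le_one_iff, neg_div]
      have : 0 ≤ ‖x - x₀‖ ^ 2 / (C₂ * (T - t)) := by
        have : 0 < T - t := by linarith
        positivity
      linarith
    have h2 : (T - t) ^ (-(3:ℝ) / 2) ≤ (T - t₂) ^ (-(3:ℝ) / 2) :=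
      Real.rpow_le_rpow_of_nonpos (by linarith) (by linarith) (by norm_num)
    have h3 : 0 ≤ C₁ * (T - t) ^ (-(3:ℝ) / 2) := by
      have : 0 < T - t := by linarith
      positivity
    calc C₁ * (T - t) ^ (-(3:ℝ) / 2) * Real.exp (-(‖x - x₀‖ ^ 2) / (C₂ * (T - t)))
        ≤ C₁ * (T - t) ^ (-(3:ℝ) / 2) * 1 := mul_le_mul_of_nonneg_left h1 h3
      _ ≤ C₁ * (T - t₂) ^ (-(3:ℝ) / 2) := by
          rw [mul_one]; exact mul_le_mul_of_nonneg_left h2 hC₁.le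
  have hsup : ∀ t₂ : ℝ, t₂ < T → ∀ n, ∀ t ∈ Ioc tₘ t₂, ∀ x,
      |Gs n t x| ≤ C₁ * (T - t₂) ^ (-(3:ℝ) / 2) := by
    intro t₂ ht₂ n t ht x
    have htI : t ∈ Ioo tₘ T := ⟨ht.1, ht.2.trans_lt ht₂⟩
    rw [abs_of_pos ((hK n).pos t (hIco htI) x)]
    exact (hU n t htI x).trans (hup_le t₂ ht₂ t ht.2 x)
  /- Step 2: extraction -/
  have hcont : ∀ n, ∀ t ∈ Ioo tₘ T, Continuous (Gs n t) := fun n t ht =>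
    ((hK n).contDiff_slice (hIco ht)).continuous
  have hposs : ∀ n, ∀ t ∈ Ioo tₘ T, ∀ x, 0 ≤ Gs n t x := fun n t ht x =>
    ((hK n).pos t (hIco ht) x).le
  have hints : ∀ n, ∀ t ∈ Ioo tₘ T, Integrable (Gs n t) := fun n t ht =>
    (hK n).integrable (hIco ht)
  have hmass1 : ∀ n, ∀ t ∈ Ioo tₘ T, ∫ x, Gs n t x ≤ 1 := fun n t ht =>
    ((hK n).integral_eq_one t (hIco ht)).le
  have hequi_t : ∀ ψ : EuclideanSpace ℝ (Fin 3) → ℝ, ContDiff ℝ ∞ ψ → HasCompactSupport ψ →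
      ∀ t₁ t₂ : ℝ, tₘ < t₁ → t₂ < T → ∃ L : ℝ, ∀ n, ∀ s ∈ Icc t₁ t₂, ∀ t ∈ Icc t₁ t₂,
        |(∫ x, ψ x * Gs n t x) - ∫ x, ψ x * Gs n s x| ≤ L * |t - s| := by
    intro ψ hψ hψc t₁ t₂ h₁ h₂
    obtain ⟨Bd, hBd0, hBd⟩ := hBd t₁ t₂ h₁.le h₂
    have hψ2 : ContDiff ℝ 2 ψ := hψ.of_le (by norm_cast)
    obtain ⟨M₁, hM₁⟩ := (hψ2.continuous_fderiv (by norm_num)).bounded_above_of_compact_support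
      (hψc.fderiv (𝕜 := ℝ))
    have hΔc : HasCompactSupport (Δ ψ) :=
      HasCompactSupport.intro hψc (fun x hx => laplacian_eq_zero_of_notMem_tsupport hx)
    obtain ⟨M₂, hM₂⟩ := (continuous_laplacian hψ2).bounded_above_of_compact_support hΔc
    refine ⟨Bd * M₁ + ν * M₂, fun n s hs t ht => ?_⟩
    exact kernelLimit_pairing_lipschitz hν.le (hsm' n) (hdiv' n) (hK n) hψ2 hψc h₁ h₂ hBd0
      (fun r hr x _ => hBd n r hr x) hM₁ (fun x => by rw [← Real.norm_eq_abs]; exact hM₂ x) hs ht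
  have hequi_x : ∀ t ∈ Ioo tₘ T, ∀ x : EuclideanSpace ℝ (Fin 3), ∀ ε : ℝ, 0 < ε → ∃ δ : ℝ, 0 < δ ∧
      ∀ n (y : EuclideanSpace ℝ (Fin 3)), ‖y - x‖ ≤ δ → |Gs n t y - Gs n t x| ≤ ε := by
    intro t ht x ε hε
    set τ : ℝ := (T - t) / 2 with hτ
    have hτ0 : 0 < τ := by rw [hτ]; linarith [ht.2]
    have htT : t + τ < T := by rw [hτ]; linarith [ht.2]
    obtain ⟨Bd, hBd0, hBd⟩ := hBd t (t + τ) ht.1.le htT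
    set M : ℝ := C₁ * (T - (t + τ)) ^ (-(3:ℝ) / 2) with hM
    have hM0 : 0 < M := by
      rw [hM]; have : 0 < T - (t + τ) := sub_pos.2 htT; positivity
    have hGM : ∀ n, ∀ s ∈ Icc t (t + τ), ∀ z, |Gs n s z| ≤ M := fun n s hs z =>
      hsup (t + τ) htT n s ⟨ht.1.trans_le hs.1, hs.2⟩ z
    set ρ : ℝ := Real.sqrt (ν * τ) with hρ
    have hρ0 : 0 < ρ := Real.sqrt_pos.2 (mul_pos hν hτ0)
    have hρτ : ρ ^ 2 ≤ ν * τ := by rw [hρ, Real.sq_sqrt (mul_pos hν hτ0).le]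
    have hA : 0 ≤ Bd / ν := div_nonneg hBd0 hν.le
    set δ : ℝ := min (lipRad (Bd / ν) ρ)
      (ε / (lipConst (Bd / ν) ρ (Module.finrank ℝ (EuclideanSpace ℝ (Fin 3))) * M + 1)) with hδ
    have hLc : 0 < lipConst (Bd / ν) ρ (Module.finrank ℝ (EuclideanSpace ℝ (Fin 3))) :=
      lipConst_pos hA hρ0 (Nat.cast_nonneg _)
    have hδ0 : 0 < δ := lt_min (lipRad_pos hA hρ0) (by positivity)
    refine ⟨δ, hδ0, fun n y hy => ?_⟩
    exact kernelLimit_space_modulus hν ht.1 hτ0 htT (hsm' n) (fun s hs z => hBd n s hs z) hBd0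
      (hK n) hM0 (hGM n) hρ0 hρτ hε x y hy
  obtain ⟨φs, hφs, Glim, hconv⟩ := kernelLimit_extract hcont hposs hints hmass1 hequi_t hequi_x
  /- Step 3: properties of the limit -/
  have hφs_ge : ∀ n, n ≤ φs n := fun n => hφs.id_le n
  have hTn_ev' : ∀ t : ℝ, t < T → ∃ N : ℕ, ∀ n, N ≤ n → t ≤ Tn (φs n) := by
    intro t ht
    obtain ⟨N, hN⟩ := hTn_ev t ht
    exact ⟨N, fun n hn => (hN n hn).trans (hTn_mono n (φs n) (hφs_ge n))⟩
  have hcontO : ∀ n, ContinuousOn (fun p : ℝ × EuclideanSpace ℝ (Fin 3) => Gs (φs n) p.1 p.2) O :=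
    fun n => (hK (φs n)).contDiffOn.continuousOn.mono (prod_mono hIco Subset.rfl)
  have hboundO : ∀ t₂ : ℝ, t₂ < T → ∃ Mb : ℝ, ∀ n, ∀ t ∈ Ioc tₘ t₂, ∀ x,
      |Gs (φs n) t x| ≤ Mb := fun t₂ ht₂ => ⟨_, fun n => hsup t₂ ht₂ (φs n)⟩
  have hweakn : ∀ n, ∀ φ : ℝ × EuclideanSpace ℝ (Fin 3) → ℝ, ContDiff ℝ ∞ φ →
      HasCompactSupport φ → tsupport φ ⊆ O →
      ∫ p : ℝ × EuclideanSpace ℝ (Fin 3), Gs (φs n) p.1 p.2 * (deriv (fun s => φ (s, p.2)) p.1 +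
        fderiv ℝ (fun y => φ (p.1, y)) p.2 (bs (φs n) p.1 p.2) -
          ν * (Δ (fun y => φ (p.1, y))) p.2) = 0 :=
    fun n φ hφ hφc hφsupp => kernelLimit_veryWeak_of_adapted (hsm' _) (hdiv' _) (hK _) hφ hφc hφsupp
  have hloc := kernelLimit_locallyIntegrableOn_limit hcontO hboundO hconv
  have hweak := kernelLimit_veryWeak_limit (ν := ν) hb hTn_ev' (fun n => hagree (φs n)) hcontO
    hboundO hconv hweakn
  have hGlimL : ∀ t ∈ Ioo tₘ T, ∀ x, lo t x ≤ Glim t x := fun t ht x =>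
    ge_of_tendsto (hconv t ht x) (Eventually.of_forall fun n => hL (φs n) t ht x)
  have hGlimU : ∀ t ∈ Ioo tₘ T, ∀ x, Glim t x ≤ up t x := fun t ht x =>
    le_of_tendsto (hconv t ht x) (Eventually.of_forall fun n => hU (φs n) t ht x)
  have hGlim_mass : ∀ t ∈ Ioo tₘ T, ∫ x, Glim t x = 1 := by
    intro t ht
    have hh : 0 < T - t := sub_pos.2 ht.2
    obtain ⟨henv_i, -⟩ := kernelLimit_envelope_integral (C₁ := C₁) hC₂ hh x₀
    have hlim : Tendsto (fun n => ∫ x, Gs (φs n) t x) atTop (𝓝 (∫ x, Glim t x)) := by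
      refine tendsto_integral_of_dominated_convergence (fun x => up t x)
        (fun n => (hcont (φs n) t ht).aestronglyMeasurable) henv_i (fun n => ?_) ?_
      · refine Eventually.of_forall fun x => ?_
        rw [Real.norm_eq_abs, abs_of_nonneg (hposs (φs n) t ht x)]
        exact hU (φs n) t ht x
      · exact Eventually.of_forall fun x => hconv t ht x
    have h1 : Tendsto (fun n => ∫ x, Gs (φs n) t x) atTop (𝓝 1) :=
      tendsto_const_nhds.congr fun n => ((hK (φs n)).integral_eq_one t (hIco ht)).symm
    exact tendsto_nhds_unique hlim h1
  /- Step 4: hypoelliptic smoothing -/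
  obtain ⟨g, hgs, hae, hcl⟩ := hH ν tₘ T b (fun p => Glim p.1 p.2) hν htₘT hb hdiv hloc hweak
  have hgc : ContinuousOn (fun p : ℝ × EuclideanSpace ℝ (Fin 3) => g p.1 p.2) O := hgs.continuousOn
  -- continuity of the envelopes on the open slab
  have henv_c : ∀ (K a : ℝ), 0 < a →
      ContinuousOn (fun p : ℝ × EuclideanSpace ℝ (Fin 3) =>
        K * (T - p.1) ^ (-(3:ℝ) / 2) * Real.exp (-(‖p.2 - x₀‖ ^ 2) / (a * (T - p.1)))) O := by
    intro K a ha
    have hT : ∀ p ∈ O, T - p.1 ≠ 0 := fun p hp => (sub_pos.2 hp.1.2).ne'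
    refine ContinuousOn.mul (continuousOn_const.mul ?_) ?_
    · exact (continuousOn_const.sub continuousOn_fst).rpow_const fun p hp => Or.inl (hT p hp)
    · refine Real.continuous_exp.comp_continuousOn ?_
      refine ContinuousOn.div ?_ ?_ fun p hp => mul_ne_zero ha.ne' (hT p hp)
      · exact ((continuous_snd.sub continuous_const).norm.pow 2).neg.continuousOn
      · exact continuousOn_const.mul (continuousOn_const.sub continuousOn_fst)
  -- the bounds transfer to `g` everywhere on the slab
  have hgL : ∀ t ∈ Ioo tₘ T, ∀ x, lo t x ≤ g t x := by
    intro t ht x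
    have h := kernelLimit_le_of_ae_le (E := EuclideanSpace ℝ (Fin 3)) hO
      (f := fun p => lo p.1 p.2) (h := fun p => g p.1 p.2) (henv_c c₁ c₂ hc₂) hgc ?_ (t, x) ⟨ht, mem_univ x⟩
    · exact h
    · filter_upwards [hae] with p hp hpO
      rw [← hp hpO]
      exact hGlimL p.1 hpO.1 p.2
  have hgU : ∀ t ∈ Ioo tₘ T, ∀ x, g t x ≤ up t x := by
    intro t ht x
    have h := kernelLimit_le_of_ae_le (E := EuclideanSpace ℝ (Fin 3)) hO
      (f := fun p => g p.1 p.2) (h := fun p => up p.1 p.2) hgc (henv_c C₁ C₂ hC₂) ?_ (t, x) ⟨ht, mem_univ x⟩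
    · exact h
    · filter_upwards [hae] with p hp hpO
      rw [← hp hpO]
      exact hGlimU p.1 hpO.1 p.2
  have hgpos : ∀ t ∈ Ioo tₘ T, ∀ x, 0 < g t x := fun t ht x =>
    (hlo_pos t ht.2 x).trans_le (hgL t ht x)
  have hgint : ∀ t ∈ Ioo tₘ T, Integrable (g t) := by
    intro t ht
    obtain ⟨henv_i, -⟩ := kernelLimit_envelope_integral (C₁ := C₁) hC₂ (sub_pos.2 ht.2) x₀
    refine henv_i.mono' (hgs.continuousOn.comp_continuous (f := fun x => (t, x))
      (continuous_const.prodMk continuous_id) (fun x => ⟨ht, mem_univ x⟩)).aestronglyMeasurable ?_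
    refine Eventually.of_forall fun x => ?_
    rw [Real.norm_eq_abs, abs_of_pos (hgpos t ht x)]
    exact hgU t ht x
  -- unit mass of `g`: a.e. in `t`, then everywhere by continuity of `t ↦ ∫ g(t)`
  have hgmass_ae : ∀ᵐ t ∂(volume : Measure ℝ), t ∈ Ioo tₘ T → ∫ x, g t x = 1 := by
    have h2 := kernelLimit_ae_ae (E := EuclideanSpace ℝ (Fin 3)) hae
    filter_upwards [h2] with t ht htI
    rw [← hGlim_mass t htI]
    refine integral_congr_ae ?_
    filter_upwards [ht] with x hx
    exact (hx ⟨htI, mem_univ x⟩).symm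
  have hgmass_cont : ContinuousOn (fun t => ∫ x, g t x) (Ioo tₘ T) := by
    intro t ht
    refine ContinuousAt.continuousWithinAt ?_
    -- a compact time interval around `t` and a common Gaussian bound there
    obtain ⟨ε, hε, hεI⟩ : ∃ ε : ℝ, 0 < ε ∧ Icc (t - ε) (t + ε) ⊆ Ioo tₘ T := by
      have hm : 0 < min (t - tₘ) (T - t) := lt_min (sub_pos.2 ht.1) (sub_pos.2 ht.2)
      refine ⟨min (t - tₘ) (T - t) / 2, by positivity, fun s hs => ⟨?_, ?_⟩⟩
      · have h1 : min (t - tₘ) (T - t) ≤ t - tₘ := min_le_left _ _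
        linarith [hs.1]
      · have h1 : min (t - tₘ) (T - t) ≤ T - t := min_le_right _ _
        linarith [hs.2]
    have htε : t + ε < T := (hεI ⟨by linarith, le_rfl⟩).2
    have h1 : 0 < T - t - ε := by linarith
    have h2 : 0 < T - t + ε := by linarith
    obtain ⟨hgauss_i, -⟩ := kernelLimit_gaussian_integral (mul_pos hC₂ h2) x₀
    refine continuousAt_of_dominated (bound := fun x => C₁ * (T - t - ε) ^ (-(3:ℝ) / 2) *
        Real.exp (-(‖x - x₀‖ ^ 2) / (C₂ * (T - t + ε)))) ?_ ?_ (hgauss_i.const_mul _) ?_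
    · filter_upwards [Icc_mem_nhds (show t - ε < t by linarith) (show t < t + ε by linarith)]
        with s hs
      exact (hgint s (hεI hs)).aestronglyMeasurable
    · filter_upwards [Icc_mem_nhds (show t - ε < t by linarith) (show t < t + ε by linarith)]
        with s hs
      have hsI := hεI hs
      refine Eventually.of_forall fun x => ?_
      rw [Real.norm_eq_abs, abs_of_pos (hgpos s hsI x)]
      refine (hgU s hsI x).trans ?_
      simp only [hup]
      have hTs : 0 < T - s := sub_pos.2 hsI.2
      have e1 : (T - s) ^ (-(3:ℝ) / 2) ≤ (T - t - ε) ^ (-(3:ℝ) / 2) :=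
        Real.rpow_le_rpow_of_nonpos h1 (by linarith [hs.2]) (by norm_num)
      have e2 : Real.exp (-(‖x - x₀‖ ^ 2) / (C₂ * (T - s))) ≤
          Real.exp (-(‖x - x₀‖ ^ 2) / (C₂ * (T - t + ε))) := by
        rw [Real.exp_le_exp, neg_div, neg_div, neg_le_neg_iff]
        exact div_le_div_of_nonneg_left (sq_nonneg _) (by positivity)
          (mul_le_mul_of_nonneg_left (by linarith [hs.1]) hC₂.le)
      gcongr
    · refine Eventually.of_forall fun x => ?_
      have hx : ContinuousAt (fun p : ℝ × EuclideanSpace ℝ (Fin 3) => g p.1 p.2) (t, x) :=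
        (hgc (t, x) ⟨ht, mem_univ x⟩).continuousAt (hO.mem_nhds ⟨ht, mem_univ x⟩)
      have h2 : ContinuousAt (fun s : ℝ => ((s, x) : ℝ × EuclideanSpace ℝ (Fin 3))) t :=
        (continuous_id.prodMk continuous_const).continuousAt
      exact ContinuousAt.comp (g := fun p : ℝ × EuclideanSpace ℝ (Fin 3) => g p.1 p.2)
        (f := fun s : ℝ => ((s, x) : ℝ × EuclideanSpace ℝ (Fin 3))) (x := t) hx h2
  have hgmass : ∀ t ∈ Ioo tₘ T, ∫ x, g t x = 1 := by
    have hae' : (fun t => ∫ x, g t x) =ᵐ[volume.restrict (Ioo tₘ T)] fun _ => (1 : ℝ) := by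
      rw [EventuallyEq, ae_restrict_iff' measurableSet_Ioo]
      exact hgmass_ae
    exact Measure.eqOn_open_of_ae_eq hae' isOpen_Ioo hgmass_cont continuousOn_const
  /- Step 5: packaging on `Ico t₀ T` -/
  have hI₀ : Ico t₀ T ⊆ Ioo tₘ T := fun t ht => ⟨htₘ₀.trans_le ht.1, ht.2⟩
  have hconc : ∀ φ : EuclideanSpace ℝ (Fin 3) → ℝ, Continuous φ → (∃ M : ℝ, ∀ x, |φ x| ≤ M) →
      Tendsto (fun t => ∫ x, φ x * g t x) (𝓝[<] T) (𝓝 (φ x₀)) := by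
    intro φ hφ hM
    obtain ⟨M, hM⟩ := hM
    exact kernelLimit_concentration hC₁ hC₂ ht₀T (fun t ht x => (hgpos t (hI₀ ht) x).le)
      (fun t ht => hgint t (hI₀ ht)) (fun t ht => hgmass t (hI₀ ht))
      (fun t ht x => hgU t (hI₀ ht) x) hφ hM
  have hadj : ∀ t ∈ Ico t₀ T, ∀ x,
      timeDerivWithin (Ico t₀ T) g t x + fderiv ℝ (g t) x (b t x) + ν * (Δ (g t)) x = 0 := by
    intro t ht x
    have htO : t ∈ Ioo tₘ T := hI₀ ht
    have hd : HasFDerivAt (uncurry g) (fderiv ℝ (uncurry g) (t, x)) (t, x) :=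
      ((hgs.differentiableOn (by simp)).differentiableAt (hO.mem_nhds ⟨htO, mem_univ x⟩)).hasFDerivAt
    have htl := hasDerivAt_timeLine hd
    rw [timeDerivWithin_apply, htl.hasDerivWithinAt.derivWithin (uniqueDiffOn_Ico t₀ T t ht),
      ← htl.deriv]
    exact hcl t htO x
  refine ⟨g, ⟨?_, fun t ht x => hgpos t (hI₀ ht) x, hadj, fun t ht => hgmass t (hI₀ ht), hconc⟩,
    fun t ht x => hgL t (hI₀ ht) x, fun t ht x => hgU t (hI₀ ht) x⟩
  exact (hgs.of_le (by norm_cast)).mono (prod_mono hI₀ Subset.rfl)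

/-- **Registered STUB `stub_kernelLimit` of line `nash-entropy-last-block`** — passage to the
limit along a family of uniformly comparable adapted kernels (compactness by equicontinuity,
very weak limit, Hörmander's hypoellipticity via the landed `stub_hypoelliptic`). -/
theorem stub_kernelLimit :
    ∀ (ν c₁ c₂ C₁ C₂ tₘ t₀ T : ℝ) (b : ℝ → EuclideanSpace ℝ (Fin 3) → EuclideanSpace ℝ (Fin 3))
      (x₀ : EuclideanSpace ℝ (Fin 3)),
      0 < ν → 0 < c₁ → 0 < c₂ → 0 < C₁ → 0 < C₂ → tₘ < t₀ → t₀ < T →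
      IsSmoothSpaceTimeOn (Ico tₘ T) b →
      (∀ t ∈ Ico tₘ T, VectorCalculus.IsDivFree (b t)) →
      (∀ t₁ t₂ : ℝ, tₘ ≤ t₁ → t₂ < T → ∃ Bd : ℝ, ∀ s ∈ Icc t₁ t₂, ∀ x, ‖b s x‖ ≤ Bd) →
      (∀ T' : ℝ, t₀ < T' → T' < T →
        ∃ (b' : ℝ → EuclideanSpace ℝ (Fin 3) → EuclideanSpace ℝ (Fin 3))
          (G' : ℝ → EuclideanSpace ℝ (Fin 3) → ℝ),
          (∀ t ∈ Icc tₘ T', b' t = b t) ∧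
          IsSmoothSpaceTimeOn (Ico tₘ T) b' ∧
          (∀ t ∈ Ico tₘ T, VectorCalculus.IsDivFree (b' t)) ∧
          (∀ t ∈ Ico tₘ T, ∀ x, ‖b' t x‖ ≤ ‖b t x‖) ∧
          IsAdaptedBackwardKernel ν b' (Ico tₘ T) T x₀ G' ∧
          (∀ t ∈ Ioo tₘ T, ∀ x,
            c₁ * (T - t) ^ (-(3:ℝ) / 2) * Real.exp (-(‖x - x₀‖ ^ 2) / (c₂ * (T - t))) ≤ G' t x) ∧
          (∀ t ∈ Ioo tₘ T, ∀ x,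
            G' t x ≤ C₁ * (T - t) ^ (-(3:ℝ) / 2) * Real.exp (-(‖x - x₀‖ ^ 2) / (C₂ * (T - t))))) →
      ∃ G : ℝ → EuclideanSpace ℝ (Fin 3) → ℝ,
        IsAdaptedBackwardKernel ν b (Ico t₀ T) T x₀ G ∧
        (∀ t ∈ Ico t₀ T, ∀ x,
          c₁ * (T - t) ^ (-(3:ℝ) / 2) * Real.exp (-(‖x - x₀‖ ^ 2) / (c₂ * (T - t))) ≤ G t x) ∧
        (∀ t ∈ Ico t₀ T, ∀ x,
          G t x ≤ C₁ * (T - t) ^ (-(3:ℝ) / 2) * Real.exp (-(‖x - x₀‖ ^ 2) / (C₂ * (T - t)))) :=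
  kernelLimit_of_hypoelliptic stub_hypoelliptic

end Three

end Summit.NavierStokesRegularity.NavierStokesRegularity.Theorems.AdaptedKernelExists.NashEntropyLastBlock

end
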